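import Mathlib
import HarnessLib
import Summits.NavierStokesRegularity.NavierStokesRegularity.Theorems.PoloidalWindowDoorPoloidalWindowRigiditySparseEnergyScaledEnergy
import Summits.NavierStokesRegularity.NavierStokesRegularity.Theorems.PoloidalWindowDoorPoloidalWindowRigiditySparseEnergyFarOscillation

/-!
# Route `PoloidalWindowDoor`, crux `PoloidalWindowRigidity` (stmt-19708), line `sparse_energy` — A CONSEQUENCE OF S1 AND THE WINDOW SPLIT:
# THE SCALE-INVARIANT PRESSURE SPLIT OF A TYPE-I PROFILE (`L²` part `O(R/(−t))`, bounded part `O(R⁻²)`)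

Seat ns-poloidal-K2-p2 g10 (LEAD-lineage on 19708; file `--supports`).  Feeding S1 (`…SparseEnergyScaledEnergy.scaledEnergy`:
`∫⁻_{B_ρ(a)}|v(t)|² ≤ K·ρ`) back into the window pressure split `…SparseEnergyWindowSplit.window_split` makes the split SCALE-INVARIANT:
for every window `(T,0)` the classical pressure `q` satisfies, on every ball `B̄(a,2R)` at every `t ∈ (T,0)`,

  `q(t) = c + p₁ + r`,  `∫_{B̄(a,2R)} p₁² ≤ A·R/(−t)`,  `|r| ≤ B/R²` on `B̄(a,2R)`,

with `A = 24κ₁²C²K`, `B = 7κ₂K` independent of `T, t, a, R` (`scaledPressure_split`).  Ingredients: `integral_cutoff_mul_norm_sq_le_of_scaledEnergy`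
(`∫ cutoff(ρ)(a−·)|v(t)|² ≤ 3Kρ`) and `tsum_dyadicEnergy_le_of_scaledEnergy` (`Σ_k (2^kR)⁻⁴ ∫ cutoff(2^{k+1}R)(a−·)|v(t)|² ≤ (48/7)·K/R³`).
By Hölder on `B_R × (t₀−R², t₀)` this bounds the CKN pressure quantity `D(R)` uniformly (with S1: `A, E`, and `…ScaledCubic`: `C`), i.e. the class is
«Type I in all scaled quantities» at every scale, centre and apex time.

WHAT THIS IS NOT: not a claim about Navier–Stokes regularity; an a-priori estimate for hypothetical Type-I ancient profiles (bears_on LADDER-NS N0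
via crux 19708, line sparse_energy). [folklore]
-/

noncomputable section

-- the summit and its single sub-problem share the name (CONVENTIONS §1), as in every Theorems file
set_option linter.dupNamespace false

namespace Summit.NavierStokesRegularity.NavierStokesRegularity.Theorems.PoloidalWindowDoorPoloidalWindowRigiditySparseEnergyScaledPressure

open MeasureTheory Set Function Filter Topology Metric
open scoped ENNReal
open Literature.Analysis Literature.Analysis.FluidPDE
open Summit.NavierStokesRegularity.NavierStokesRegularity.Theorems.PoloidalWindowDoorPoloidalWindowRigiditySparseEnergyScaledEnergy
open Summit.NavierStokesRegularity.NavierStokesRegularity.Theorems.PoloidalWindowDoorPoloidalWindowRigiditySparseEnergyWindowSplit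
open Summit.NavierStokesRegularity.NavierStokesRegularity.Theorems.PoloidalWindowDoorPoloidalWindowRigiditySparseEnergyFarOscillation

variable {C : ℝ} {v : ℝ → EuclideanSpace ℝ (Fin 3) → EuclideanSpace ℝ (Fin 3)}

/-- **Cut-off energies are controlled by the scale-invariant energy**: if `∫⁻_{B_ρ(a)} |u|² ≤ K·ρ` for all centres and radii, then
`∫ cutoff(ρ)(a−x) |u x|² dx ≤ 3·K·ρ` for `u` continuous (the cut-off lives in `B(a,3ρ)` and is `≤ 1`). [folklore] -/
theorem integral_cutoff_mul_norm_sq_le_of_scaledEnergy {u : EuclideanSpace ℝ (Fin 3) → EuclideanSpace ℝ (Fin 3)} (hu : Continuous u)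
    {K : ℝ} (hK0 : 0 ≤ K)
    (hK : ∀ (a : EuclideanSpace ℝ (Fin 3)) (ρ : ℝ), 0 < ρ → (∫⁻ x in ball a ρ, ENNReal.ofReal (‖u x‖ ^ 2)) ≤ ENNReal.ofReal (K * ρ))
    (a : EuclideanSpace ℝ (Fin 3)) {ρ : ℝ} (hρ : 0 < ρ) :
    ∫ x, cutoff ρ (a - x) * ‖u x‖ ^ 2 ≤ 3 * K * ρ := by
  have hfi : Integrable fun x => cutoff ρ (a - x) * ‖u x‖ ^ 2 := integrable_cutoff_mul_norm_sq hu hρ a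
  have hu2 : Continuous fun x => ‖u x‖ ^ 2 := hu.norm.pow 2
  have hint : IntegrableOn (fun x => ‖u x‖ ^ 2) (ball a (3 * ρ)) :=
    (hu2.continuousOn.integrableOn_compact (isCompact_closedBall a (3 * ρ))).mono_set ball_subset_closedBall
  -- the cut-off integrand vanishes off `B(a,3ρ)` and is dominated by `|u|²` on it
  have hzero : ∀ x, x ∉ ball a (3 * ρ) → cutoff ρ (a - x) * ‖u x‖ ^ 2 = 0 := by
    intro x hx
    rw [mem_ball, dist_eq_norm, not_lt] at hx
    rw [cutoff_eq_zero hρ (by rw [← norm_neg, neg_sub]; linarith), zero_mul]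
  have h1 : ∫ x, cutoff ρ (a - x) * ‖u x‖ ^ 2 = ∫ x in ball a (3 * ρ), cutoff ρ (a - x) * ‖u x‖ ^ 2 :=
    (setIntegral_eq_integral_of_forall_compl_eq_zero hzero).symm
  have h2 : ∫ x in ball a (3 * ρ), cutoff ρ (a - x) * ‖u x‖ ^ 2 ≤ ∫ x in ball a (3 * ρ), ‖u x‖ ^ 2 := by
    refine setIntegral_mono_on hfi.integrableOn hint measurableSet_ball fun x _ => ?_
    calc cutoff ρ (a - x) * ‖u x‖ ^ 2 ≤ 1 * ‖u x‖ ^ 2 := by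
          gcongr; exact cutoff_le_one _ _
      _ = ‖u x‖ ^ 2 := one_mul _
  have h3 : ∫ x in ball a (3 * ρ), ‖u x‖ ^ 2 ≤ 3 * K * ρ := by
    have hb := hK a (3 * ρ) (by positivity)
    rw [← ofReal_integral_eq_lintegral_ofReal hint (ae_of_all _ fun x => sq_nonneg _)] at hb
    have := (ENNReal.ofReal_le_ofReal_iff (by positivity)).1 hb
    linarith
  linarith

/-- `((2^k)⁻¹)³ = (1/8)^k`. [folklore] -/
theorem inv_two_pow_cube (k : ℕ) : (((2 : ℝ) ^ k)⁻¹) ^ 3 = (1 / 8 : ℝ) ^ k := by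
  have h : ((2 : ℝ) ^ k) ^ 3 = (8 : ℝ) ^ k := by
    rw [← pow_mul, mul_comm, pow_mul]; norm_num
  rw [inv_pow, h, one_div, inv_pow]

/-- **The dyadic far sums are `O(R⁻³)` under the scale-invariant energy**:
`Σ'_k ((2^kR)⁻¹)⁴ ∫ cutoff(2^{k+1}R)(a−x)|u x|² dx ≤ (48/7)·K/R³`. [folklore] -/
theorem tsum_dyadicEnergy_le_of_scaledEnergy {u : EuclideanSpace ℝ (Fin 3) → EuclideanSpace ℝ (Fin 3)} (hu : Continuous u) {N : ℝ}
    (hN : ∀ y, ‖u y‖ ≤ N) {K : ℝ} (hK0 : 0 ≤ K)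
    (hK : ∀ (a : EuclideanSpace ℝ (Fin 3)) (ρ : ℝ), 0 < ρ → (∫⁻ x in ball a ρ, ENNReal.ofReal (‖u x‖ ^ 2)) ≤ ENNReal.ofReal (K * ρ))
    (a : EuclideanSpace ℝ (Fin 3)) {R : ℝ} (hR : 0 < R) :
    ∑' k : ℕ, ((2 : ℝ) ^ k * R)⁻¹ ^ 4 * ∫ x, cutoff ((2 : ℝ) ^ (k + 1) * R) (a - x) * ‖u x‖ ^ 2 ≤ 48 / 7 * K / R ^ 3 := by
  have hterm : ∀ k : ℕ, ((2 : ℝ) ^ k * R)⁻¹ ^ 4 * ∫ x, cutoff ((2 : ℝ) ^ (k + 1) * R) (a - x) * ‖u x‖ ^ 2 ≤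
      6 * K / R ^ 3 * (1 / 8 : ℝ) ^ k := by
    intro k
    have h2k : 0 < (2 : ℝ) ^ k := pow_pos two_pos k
    have hρ : 0 < (2 : ℝ) ^ (k + 1) * R := by positivity
    calc ((2 : ℝ) ^ k * R)⁻¹ ^ 4 * ∫ x, cutoff ((2 : ℝ) ^ (k + 1) * R) (a - x) * ‖u x‖ ^ 2
        ≤ ((2 : ℝ) ^ k * R)⁻¹ ^ 4 * (3 * K * ((2 : ℝ) ^ (k + 1) * R)) := by
          gcongr
          exact integral_cutoff_mul_norm_sq_le_of_scaledEnergy hu hK0 hK a hρ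
      _ = 6 * K / R ^ 3 * (((2 : ℝ) ^ k)⁻¹) ^ 3 := by
          rw [pow_succ]
          field_simp
          ring
      _ = 6 * K / R ^ 3 * (1 / 8 : ℝ) ^ k := by rw [inv_two_pow_cube]
  have hgeo : HasSum (fun k : ℕ => 6 * K / R ^ 3 * (1 / 8 : ℝ) ^ k) (6 * K / R ^ 3 * (1 - 1 / 8)⁻¹) :=
    (hasSum_geometric_of_lt_one (by norm_num) (by norm_num)).mul_left _
  calc ∑' k : ℕ, ((2 : ℝ) ^ k * R)⁻¹ ^ 4 * ∫ x, cutoff ((2 : ℝ) ^ (k + 1) * R) (a - x) * ‖u x‖ ^ 2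
      ≤ ∑' k : ℕ, 6 * K / R ^ 3 * (1 / 8 : ℝ) ^ k :=
        (summable_dyadicEnergy hN hR a).tsum_le_tsum hterm hgeo.summable
    _ = 6 * K / R ^ 3 * (1 - 1 / 8)⁻¹ := hgeo.tsum_eq
    _ = 48 / 7 * K / R ^ 3 := by ring

/-- **THE SCALE-INVARIANT PRESSURE SPLIT OF THE TYPE-I CLASS.**  For a profile of the route's Type-I class there are `A, B ≥ 0` such that for
every window `(T,0)`, `T < 0`, its classical pressure `q` splits on every ball `B̄(a,2R)` (`R > 0`) at every time `t ∈ (T,0)` as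
`q(t,x) = c + p₁(x) + r(x)` with `p₁` continuous, `∫_{B̄(a,2R)} p₁² ≤ A·R/(−t)` and `|r| ≤ B/R²` on `B̄(a,2R)` — the window split of
`…SparseEnergyWindowSplit.window_split` made scale-invariant by S1 (`A = 24κ₁²C²K`, `B = 7κ₂K`). [folklore] -/
theorem scaledPressure_split (hrate : HasTypeITimeDecay C v)
    (hcont : ContinuousOn (uncurry v) (Iio (0 : ℝ) ×ˢ univ))
    (hmild : ∀ s t : ℝ, s < t → t < 0 → ∀ x,
      v t x = UnboundedOperators.heatExtension (v s) (t - s) x - oseenDuhamel 1 s v v t x)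
    (hdiv : ∀ t < 0, VectorCalculus.IsDivFree (v t)) :
    ∃ A B : ℝ, 0 ≤ A ∧ 0 ≤ B ∧ ∀ T : ℝ, T < 0 → ∃ q : ℝ → EuclideanSpace ℝ (Fin 3) → ℝ,
      IsClassicalNSSolutionOn (Ioo T 0) 1 0 v q ∧
      ∀ t ∈ Ioo T 0, ∀ (a : EuclideanSpace ℝ (Fin 3)) (R : ℝ), 0 < R →
        ∃ (c : ℝ) (p₁ : EuclideanSpace ℝ (Fin 3) → ℝ), Continuous p₁ ∧
          (∫ x in closedBall a (2 * R), p₁ x ^ 2) ≤ A * R / (-t) ∧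
          ∀ x ∈ closedBall a (2 * R), |q t x - c - p₁ x| ≤ B / R ^ 2 := by
  have hC0 : 0 ≤ C := by
    have h := hrate (-1) (by norm_num) 0
    rw [neg_neg, Real.sqrt_one, div_one] at h
    exact (norm_nonneg _).trans h
  obtain ⟨κ₁, κ₂, hκ₁0, hκ₂0, hwin⟩ := window_split hrate hcont hmild hdiv
  obtain ⟨K, hK0, hK⟩ := scaledEnergy hrate hcont hmild hdiv
  have hKe : ∀ t < 0, ∀ (a : EuclideanSpace ℝ (Fin 3)) (ρ : ℝ), 0 < ρ →
      (∫⁻ x in ball a ρ, ENNReal.ofReal (‖v t x‖ ^ 2)) ≤ ENNReal.ofReal (K * ρ) := fun t ht a ρ hρ => (hK t ht a ρ hρ).1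
  refine ⟨24 * κ₁ ^ 2 * C ^ 2 * K, 7 * κ₂ * K, by positivity, by positivity, fun T hT => ?_⟩
  obtain ⟨q, hcl, hsplit⟩ := hwin T hT
  refine ⟨q, hcl, fun t ht a R hR => ?_⟩
  have ht0 : t < 0 := ht.2
  have hnt : 0 < -t := neg_pos.2 ht0
  have hvc : Continuous (v t) := LocalSineTubeDoorProfileAlignedWindowRigidityAncient.continuous_slice hcont ht0
  have hNt : ∀ y, ‖v t y‖ ≤ C / Real.sqrt (-t) := fun y => hrate t ht0 y
  obtain ⟨c, p₁, p₂, hp₁c, hq, hp₁, O, hO0, hosc, hOle⟩ := hsplit t ht a R hR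
  refine ⟨c + p₂ a, p₁, hp₁c, ?_, fun x hx => ?_⟩
  · -- the `L²` part: square the window bound and insert the cut-off energy `≤ 3K·8R`
    have hE : ∫ x, cutoff (8 * R) (a - x) * ‖v t x‖ ^ 2 ≤ 3 * K * (8 * R) :=
      integral_cutoff_mul_norm_sq_le_of_scaledEnergy hvc hK0 (hKe t ht0) a (by positivity)
    have hE0 : 0 ≤ ∫ x, cutoff (8 * R) (a - x) * ‖v t x‖ ^ 2 :=
      integral_nonneg fun x => mul_nonneg (cutoff_nonneg _ _) (sq_nonneg _)
    have hX0 : 0 ≤ ∫ x in closedBall a (2 * R), p₁ x ^ 2 := setIntegral_nonneg measurableSet_closedBall fun x _ => sq_nonneg _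
    set X := ∫ x in closedBall a (2 * R), p₁ x ^ 2 with hX
    set E := ∫ x, cutoff (8 * R) (a - x) * ‖v t x‖ ^ 2 with hEdef
    have hY0 : 0 ≤ κ₁ * (C / Real.sqrt (-t)) * Real.sqrt E := by positivity
    have h1 : X ≤ (κ₁ * (C / Real.sqrt (-t)) * Real.sqrt E) ^ 2 := by
      have := hp₁
      rw [Real.sqrt_le_left hY0] at this
      exact this
    have h2 : (κ₁ * (C / Real.sqrt (-t)) * Real.sqrt E) ^ 2 = κ₁ ^ 2 * (C ^ 2 / (-t)) * E := by
      rw [mul_pow, mul_pow, div_pow, Real.sq_sqrt hnt.le, Real.sq_sqrt hE0]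
    rw [h2] at h1
    calc X ≤ κ₁ ^ 2 * (C ^ 2 / (-t)) * E := h1
      _ ≤ κ₁ ^ 2 * (C ^ 2 / (-t)) * (3 * K * (8 * R)) := by gcongr
      _ = 24 * κ₁ ^ 2 * C ^ 2 * K * R / (-t) := by
          field_simp
          ring
  · -- the bounded part: the oscillation of `p₂`, with the dyadic sums `≤ (48/7)K/R³`
    have ha : a ∈ closedBall a (2 * R) := mem_closedBall_self (by positivity)
    have hS := tsum_dyadicEnergy_le_of_scaledEnergy hvc hNt hK0 (hKe t ht0) a hR
    rw [hq x hx]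
    have e : c + p₁ x + p₂ x - (c + p₂ a) - p₁ x = p₂ x - p₂ a := by ring
    rw [e]
    calc |p₂ x - p₂ a| ≤ O := hosc x hx a ha
      _ ≤ κ₂ * R * ∑' k : ℕ, ((2 : ℝ) ^ k * R)⁻¹ ^ 4 * ∫ x, cutoff ((2 : ℝ) ^ (k + 1) * R) (a - x) * ‖v t x‖ ^ 2 := hOle
      _ ≤ κ₂ * R * (48 / 7 * K / R ^ 3) := by gcongr
      _ = 48 / 7 * (κ₂ * K) / R ^ 2 := by
          field_simp
      _ ≤ 7 * κ₂ * K / R ^ 2 := by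
          apply div_le_div_of_nonneg_right _ (by positivity)
          nlinarith [mul_nonneg hκ₂0 hK0]

end Summit.NavierStokesRegularity.NavierStokesRegularity.Theorems.PoloidalWindowDoorPoloidalWindowRigiditySparseEnergyScaledPressure

end
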